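import Mathlib.Topology.Algebra.Order.Archimedean
import Summits.NavierStokesRegularity.NavierStokesRegularity.Theorems.TypeICertificateLadderTargetRssStratumAxisymmetric
import Summits.NavierStokesRegularity.NavierStokesRegularity.Theorems.TypeICertificateLadderTargetRssStratumTwoSpeeds
import HarnessLib

/-!
# Crux `NoTypeIBlowup` (stmt-NavierStokesRegularity-1217), line `killing-twisted-bernoulli-solitons`:
  stub `rssStratum_stabilizer_cyclic` (a non-trivial window soliton has at most finite
  rotational symmetry about the axis)

Support file (theorems only, `--supports stmt-NavierStokesRegularity-1217`). Stub B5b of this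
line is Pineau–Vicol's Conjecture 1.1 (arXiv:2607.09619) in the window `α ≈ 1`: a Type-I rotated
self-similar (RSS) classical solution `u = pvAnsatz α U` on `[−1, 0)` with
`‖u(t, x)‖ ≤ C₀ / (‖x‖ + √(−t))` should be trivial. The lead catalogues the possible SYMMETRIES
of a hypothetical counterexample; this file records the structure of its ROTATIONAL STABILIZER
about the axis,

  `S(U) = {ψ : ℝ | ∀ y, U (R_ψ y) = R_ψ (U y)}`   (`R_ψ = rotZ ψ`).

* `RssStratumStabilizer.exists_addSubgroup` — `S(U)` is an additive subgroup of `ℝ`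
  (`R_0 = id`, `R_{φ+ψ} = R_φ R_ψ`; the closure properties are the public helpers
  `RssStratumTwoSpeeds.equivariant_zero/add/neg` of the two-speeds stub).
* `RssStratumStabilizer.isClosed` — `S(U)` is closed when `U` is continuous (an intersection
  over `y` of zero sets of the continuous maps `ψ ↦ U (R_ψ y) − R_ψ (U y)`).
* `RssStratumStabilizer.two_pi_mem` — `2π ∈ S(U)` (`R_{2π} = id`, `rotZ_add_two_pi'`).
* `RssStratumStabilizer.mem_closure_singleton_iff_abs` — `ℤ a = ℤ |a|` inside `ℝ`.
* `rssStratum_stabilizer_cyclic` — the registered statement: for a NON-TRIVIAL Type-I RSS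
  profile `U`, `S(U) = ψ₀ ℤ` for some `ψ₀ > 0`. By `AddSubgroup.dense_or_cyclic` the subgroup
  `S(U)` is dense or cyclic; a dense closed subgroup is all of `ℝ`, i.e. `U` is axisymmetric,
  hence trivial by the landed axisymmetric stratum `rssStratum_axisymmetric` — excluded; a
  cyclic subgroup containing `2π ≠ 0` has a generator `a ≠ 0`, and `ψ₀ = |a|`.

## References

* B. Pineau, V. Vicol, arXiv:2607.09619 (2026): Conjecture 1.1, Thm. 1.4 (p. 4), §1.2 (p. 5),
  Remark 1.5 (`R(s + 2π) = R(s)`). [PineauVicol2026]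
-/

noncomputable section

-- the summit and its single sub-problem share the name (CONVENTIONS §1), as in every Theorems file
set_option linter.dupNamespace false

namespace Summit.NavierStokesRegularity.NavierStokesRegularity.Theorems

open Literature.Analysis.FluidPDE Set

namespace RssStratumStabilizer

/-- The rotational stabilizer `S(U) = {ψ | U ∘ R_ψ = R_ψ ∘ U}` of a field `U` about the axis is
an additive subgroup of `ℝ`: it contains `0` and is closed under addition and negation
(`R_0 = id`, `R_{φ+ψ} = R_φ R_ψ`, `R_{−φ} = R_φ⁻¹`). [folklore] -/
theorem exists_addSubgroup (U : EuclideanSpace ℝ (Fin 3) → EuclideanSpace ℝ (Fin 3)) :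
    ∃ S : AddSubgroup ℝ, ∀ ψ : ℝ, ψ ∈ S ↔ ∀ y, U (rotZ ψ y) = rotZ ψ (U y) := by
  refine ⟨{ carrier := {ψ : ℝ | ∀ y, U (rotZ ψ y) = rotZ ψ (U y)}
            zero_mem' := fun y => RssStratumTwoSpeeds.equivariant_zero U y
            add_mem' := fun hφ hψ y => RssStratumTwoSpeeds.equivariant_add hφ hψ y
            neg_mem' := fun hφ y => RssStratumTwoSpeeds.equivariant_neg hφ y }, fun ψ => Iff.rfl⟩

/-- The rotational stabilizer of a CONTINUOUS field is closed: it is the intersection over `y`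
of the zero sets `{ψ | U (R_ψ y) = R_ψ (U y)}` of continuous functions of the angle (the orbit
map `θ ↦ R_θ x` has the continuous components `cos θ x₀ − sin θ x₁`, `sin θ x₀ + cos θ x₁`, `x₂`;
cf. `Literature.Analysis.FluidPDE.continuous_rotZ_angle`, not imported here). [folklore] -/
theorem isClosed {U : EuclideanSpace ℝ (Fin 3) → EuclideanSpace ℝ (Fin 3)} (hU : Continuous U)
    {S : AddSubgroup ℝ} (hS : ∀ ψ : ℝ, ψ ∈ S ↔ ∀ y, U (rotZ ψ y) = rotZ ψ (U y)) :
    IsClosed (S : Set ℝ) := by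
  have hrot : ∀ x : EuclideanSpace ℝ (Fin 3), Continuous fun θ : ℝ => rotZ θ x := by
    intro x
    unfold rotZ
    refine (PiLp.continuous_toLp 2 _).comp ?_
    refine continuous_pi fun i => ?_
    have hc : Continuous fun θ : ℝ => Real.cos θ := Real.continuous_cos
    have hs : Continuous fun θ : ℝ => Real.sin θ := Real.continuous_sin
    fin_cases i
    · exact ((hc.mul (continuous_const (y := x 0))).sub
        (hs.mul (continuous_const (y := x 1)))).congr fun θ => by simp
    · exact ((hs.mul (continuous_const (y := x 0))).add
        (hc.mul (continuous_const (y := x 1)))).congr fun θ => by simp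
    · exact (continuous_const (y := x 2)).congr fun θ => by simp
  have e : (S : Set ℝ) =
      ⋂ y : EuclideanSpace ℝ (Fin 3), {ψ : ℝ | U (rotZ ψ y) = rotZ ψ (U y)} := by
    ext ψ
    simp only [SetLike.mem_coe, Set.mem_iInter, Set.mem_setOf_eq]
    exact hS ψ
  rw [e]
  exact isClosed_iInter fun y =>
    isClosed_eq (hU.comp (hrot y)) (hrot (U y))

/-- `2π` belongs to the rotational stabilizer of every field (`R_{2π} = R_0 = id`, the tree's
`rotZ_add_two_pi'` at `θ = 0`). [folklore] -/
theorem two_pi_mem (U : EuclideanSpace ℝ (Fin 3) → EuclideanSpace ℝ (Fin 3))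
    {S : AddSubgroup ℝ} (hS : ∀ ψ : ℝ, ψ ∈ S ↔ ∀ y, U (rotZ ψ y) = rotZ ψ (U y)) :
    2 * Real.pi ∈ S := by
  have h2π : ∀ y : EuclideanSpace ℝ (Fin 3), rotZ (2 * Real.pi) y = y := fun y => by
    have h := rotZ_add_two_pi' 0 y
    rwa [zero_add, rotZ_zero] at h
  exact (hS _).2 fun y => by rw [h2π, h2π]

/-- Membership in a cyclic subgroup `ℤ a` of `ℝ` with `a ≠ 0` is membership in `ℤ |a|`
(replace `k` by `−k` if `a < 0`). [folklore] -/
theorem mem_closure_singleton_iff_abs {a : ℝ} (ha : a ≠ 0) (ψ : ℝ) :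
    ψ ∈ AddSubgroup.closure ({a} : Set ℝ) ↔ ∃ k : ℤ, ψ = k * |a| := by
  rw [AddSubgroup.mem_closure_singleton]
  simp only [zsmul_eq_mul]
  rcases lt_or_gt_of_ne ha with hneg | hpos
  · rw [abs_of_neg hneg]
    constructor
    · rintro ⟨k, hk⟩
      exact ⟨-k, by rw [Int.cast_neg]; linear_combination -hk⟩
    · rintro ⟨k, hk⟩
      exact ⟨-k, by rw [Int.cast_neg]; linear_combination -hk⟩
  · rw [abs_of_pos hpos]
    constructor
    · rintro ⟨k, hk⟩
      exact ⟨k, hk.symm⟩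
    · rintro ⟨k, hk⟩
      exact ⟨k, hk.symm⟩

end RssStratumStabilizer

/-- **The rotational stabilizer of a non-trivial window soliton is infinite cyclic.** Let `(u, p)`
be a classical Navier–Stokes solution (`ν = 1`, `f = 0`) on `[−1, 0)` with the Type-I bound
`‖u(t, x)‖ ≤ C₀ / (‖x‖ + √(−t))`, `u` the Pineau–Vicol rotated self-similar ansatz `pvAnsatz α U`
of a `C²` profile `U ≠ 0`. Then the set of angles `ψ` with `U (R_ψ y) = R_ψ (U y)` for all `y`
is `ψ₀ ℤ` for some `ψ₀ > 0` (a `k`-fold symmetry, `ψ₀ = 2π/k`). Proof: this set is a closed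
additive subgroup of `ℝ` containing `2π`; by `AddSubgroup.dense_or_cyclic` it is dense — then it
is all of `ℝ`, `U` is axisymmetric and `U = 0` by the axisymmetric stratum
`rssStratum_axisymmetric`, excluded — or cyclic with a generator `a ≠ 0`, and `ψ₀ = |a|`. [cite: PineauVicol2026, Conjecture 1.1 and §1.2 (arXiv:2607.09619 pp. 4–5), Remark 1.5] -/
theorem rssStratum_stabilizer_cyclic : ∀ (C₀ α : ℝ) (u : ℝ → EuclideanSpace ℝ (Fin 3) → EuclideanSpace ℝ (Fin 3)) (p : ℝ → EuclideanSpace ℝ (Fin 3) → ℝ) (U : EuclideanSpace ℝ (Fin 3) → EuclideanSpace ℝ (Fin 3)), Literature.Analysis.FluidPDE.IsClassicalNSSolutionOn (Set.Ico (-1) 0) 1 0 u p → (∀ t ∈ Set.Ico (-1 : ℝ) 0, ∀ x : EuclideanSpace ℝ (Fin 3), ‖u t x‖ ≤ C₀ / (‖x‖ + Real.sqrt (-t))) → ContDiff ℝ 2 U → (∀ t ∈ Set.Ico (-1 : ℝ) 0, ∀ x : EuclideanSpace ℝ (Fin 3), u t x = Literature.Analysis.FluidPDE.pvAnsatz α (fun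 y _ => U y) t x) → U ≠ 0 → ∃ ψ₀ : ℝ, 0 < ψ₀ ∧ ∀ ψ : ℝ, (∀ y : EuclideanSpace ℝ (Fin 3), U (Literature.Analysis.FluidPDE.rotZ ψ y) = Literature.Analysis.FluidPDE.rotZ ψ (U y)) ↔ ∃ k : ℤ, ψ = k * ψ₀ := by
  intro C₀ α u p U hsol hI hU hans hne
  obtain ⟨S, hS⟩ := RssStratumStabilizer.exists_addSubgroup U
  have hclosed : IsClosed (S : Set ℝ) := RssStratumStabilizer.isClosed hU.continuous hS
  rcases AddSubgroup.dense_or_cyclic S with hd | ⟨a, ha⟩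
  · -- dense case: a dense closed subgroup is `ℝ`, so `U` is axisymmetric, hence trivial
    exfalso
    have huniv : (S : Set ℝ) = Set.univ := by
      rw [← hclosed.closure_eq, hd.closure_eq]
    have hax : IsAxisymmetric U := fun θ y => by
      have hθ : θ ∈ (S : Set ℝ) := huniv ▸ Set.mem_univ θ
      exact (hS θ).1 hθ y
    exact hne (rssStratum_axisymmetric C₀ α u p U hsol hI hU hans hax)
  · -- cyclic case: the generator is non-zero since `2π ∈ S`
    have h2π : 2 * Real.pi ∈ S := RssStratumStabilizer.two_pi_mem U hS
    rw [ha] at h2π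
    obtain ⟨n, hn⟩ := AddSubgroup.mem_closure_singleton.1 h2π
    have ha0 : a ≠ 0 := by
      rintro rfl
      rw [smul_zero] at hn
      linarith [Real.two_pi_pos]
    refine ⟨|a|, abs_pos.2 ha0, fun ψ => (hS ψ).symm.trans ?_⟩
    rw [ha]
    exact RssStratumStabilizer.mem_closure_singleton_iff_abs ha0 ψ

end Summit.NavierStokesRegularity.NavierStokesRegularity.Theorems

end
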